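import Literature.NumberTheory.Automorphic.GL2CAutomorphicEval
import Literature.NumberTheory.Automorphic.GL2CCoeffRepSmooth
import Literature.NumberTheory.Automorphic.GL2CEquivariantPrimitiveGrowth
import Literature.NumberTheory.Automorphic.AutomorphicFormsGLContinuous
import HarnessLib

/-!
# Functions on `GL₂(𝔸_K)` through `(g_∞, g_f) ∈ GL₂(ℂ) × GL₂(𝔸_K^∞)` (imaginary quadratic `K`):
# smoothness in the archimedean variable, continuity, and the archimedean height

For `K` with `[K : ℚ] = 2` and totally complex (one complex place `w₀`) every `x ∈ GL₂(𝔸_K)` is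
`pt (toComplexGL x) (x_f)` (`pt_toComplexGL_sndHom`).  For a function `Φ` on `GL₂(𝔸_K)`:

* `isArchSmooth_of_contDiffOn_complex` — if `M ↦ Φ (pt M c)` is `C^∞` on the invertible matrices
  for every `c`, then `Φ` is smooth in the archimedean variable (`IsArchSmooth` for the automorphy
  datum of `GL₂`): the exponential slice `Y ↦ Φ (x · exp Y)` factors through
  `Y ↦ x_∞ exp(Y_{w₀})` (`pt_mul_expGL`), and `exp` is real-analytic;
* `continuous_of_locallyConstant_finite` — if `Φ (pt M c) = F M (c L)` with `F` continuous in `M`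
  for each coset of an open subgroup `L`, then `Φ` is continuous;
* `archHeight_pt_le_size`, `size_le_five_mul_archHeight` — the archimedean height
  `H_∞(pt M c) = max (|M_{ij}|, |(M⁻¹)_{ij}|)` against the size `s(M) = 1 + ‖M‖ + ‖M⁻¹‖` of
  `GL2CEquivariantPrimitiveGrowth`: `1 ⊔ H_∞ ≤ s(M) ≤ 5 (1 ⊔ H_∞)`.
[cite: BorelJacquetCorvallis1979, §1.1–1.2 and §4.1]

Theorems only; no named fact.
-/

noncomputable section

-- Mathlib idiom (Mathlib/Algebra/Lie/OfAssociative.lean), as in `GL2CAutomorphicEval`.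
attribute [local instance 100] LieRing.ofAssociativeRing

open scoped Matrix MatrixGroups Topology Matrix.Norms.Operator ContDiff NNReal
open Complex Filter Matrix

namespace Literature.NumberTheory.Automorphic

namespace GL2CAut

open scoped Classical
open _root_.NumberField _root_.NumberField.InfinitePlace _root_.NumberField.mixedEmbedding IsDedekindDomain
open RealMatrixGroup ComplexPlace ImaginaryQuadratic GL2CCoeff GL2C

variable (K : Type) [Field K] [NumberField K] [IsTotallyComplex K]

/-! ### Every point is `pt g_∞ g_f` -/

/-- `x = pt (toComplexGL x) (x_f)`. [cite: BorelJacquetCorvallis1979, §4.1] -/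
theorem pt_toComplexGL_sndHom (h2 : Module.finrank ℚ K = 2) (x : GL (Fin 2) (AdeleRing (𝓞 K) K)) :
    pt K (toComplexGL K 2 x) (GLn.sndHom 2 K x) = x :=
  ofComplexGL_toComplexGL_mul_ofFinite h2 x

/-- The finite component of `pt M c` is `c`. [folklore] -/
theorem sndHom_pt (M : GL (Fin 2) ℂ) (c : BigHeckeGLn.FiniteAdelicGL 2 K) : GLn.sndHom 2 K (pt K M c) = c := by
  rw [pt, map_mul, sndHom_ofComplexGL, one_mul, GLn.sndHom_ofFinite]

/-- The archimedean component of `pt M c` is `M` (through `ofComplex`). [folklore] -/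
theorem toMixed_pt (M : GL (Fin 2) ℂ) (c : BigHeckeGLn.FiniteAdelicGL 2 K) :
    GLn.toMixed 2 K (pt K M c) = Matrix.GeneralLinearGroup.map (ofComplex K) M := by
  rw [pt, map_mul, GLn.toMixed_ofFinite, mul_one, ofComplexGL, MonoidHom.comp_apply, GLn.toMixed_ofInfinite]

/-- The complex component of `pt M c` is `M`. [folklore] -/
theorem toComplexGL_pt (M : GL (Fin 2) ℂ) (c : BigHeckeGLn.FiniteAdelicGL 2 K) : toComplexGL K 2 (pt K M c) = M := by
  rw [pt, map_mul, toComplexGL_ofFinite, mul_one, toComplexGL_ofComplexGL]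

/-! ### Smoothness in the archimedean variable -/

/-- `exp` on `M₂(ℂ)` is real-smooth. [folklore] -/
theorem contDiff_exp_mat {n : WithTop ℕ∞} : ContDiff ℝ n fun Y : Mat => NormedSpace.exp Y :=
  contDiff_iff_contDiffAt.2 fun Y => by
    have h : AnalyticAt ℝ (NormedSpace.exp : Mat → Mat) Y := NormedSpace.exp_analytic Y
    exact h.contDiffAt

/-- The exponential slice through `pt`: `(pt g c) · (exp Y, 1) = pt (g · exp Y_{w₀}) c`.
[cite: BorelJacquetCorvallis1979, §4.1] -/
theorem pt_mul_ofInfinite_expMem (h2 : Module.finrank ℚ K = 2) {hcpt : isCompact_glFiniteIntegralLevel 2 K}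
    (g : GL (Fin 2) ℂ) (c : BigHeckeGLn.FiniteAdelicGL 2 K)
    (Y : (AutomorphyDatum.gl 2 K hcpt).arch.lie.toSubmodule) :
    pt K g c * GLn.ofInfinite 2 K ((AutomorphyDatum.gl 2 K hcpt).arch.expMem ⟨Y, Y.2⟩ : GL (Fin 2) (mixedSpace K)) =
      pt K (g * expGL ((Y : Matrix (Fin 2) (Fin 2) (mixedSpace K)).map (toComplex K))) c := by
  have hK : Subsingleton (InfinitePlace K) := subsingleton_infinitePlace K h2
  have h := pt_mul_expGL (K := K) hK g c ((Y : Matrix (Fin 2) (Fin 2) (mixedSpace K)).map (toComplex K)) 1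
  rw [one_smul, one_smul] at h
  rw [h]
  congr 2
  -- `expMem (placeLie (Y.map toComplex)) = expMem Y`
  have hY : (placeLie 2 (complexPlace K) ((Y : Matrix (Fin 2) (Fin 2) (mixedSpace K)).map (toComplex K)) :
      (archGroupGL 2 K).lie) = ⟨(Y : Matrix (Fin 2) (Fin 2) (mixedSpace K)), Y.2⟩ := by
    refine Subtype.ext ?_
    rw [coe_placeLie, complexPlaceLie_eq_map K hK]
    exact Matrix.ext fun i j => ofComplex_toComplex K h2 _
  rw [hY]
  rfl

/-- The real-linear map `Y ↦ Y_{w₀}` on the Lie algebra. [folklore] -/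
def lieToComplex {hcpt : isCompact_glFiniteIntegralLevel 2 K} :
    (AutomorphyDatum.gl 2 K hcpt).arch.lie.toSubmodule →ₗ[ℝ] Mat where
  toFun Y := (Y : Matrix (Fin 2) (Fin 2) (mixedSpace K)).map (toComplex K)
  map_add' Y Z := by
    rw [Submodule.coe_add]
    exact Matrix.ext fun i j => map_add (toComplex K) _ _
  map_smul' r Y := by
    rw [Submodule.coe_smul, RingHom.id_apply]
    refine Matrix.ext fun i j => ?_
    simp only [Matrix.map_apply, Matrix.smul_apply]
    rw [Algebra.smul_def, map_mul, toComplex_algebraMap, Algebra.smul_def]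
    rfl

/-- Unfolding. [folklore] -/
theorem lieToComplex_apply {hcpt : isCompact_glFiniteIntegralLevel 2 K} (Y : (AutomorphyDatum.gl 2 K hcpt).arch.lie.toSubmodule) :
    lieToComplex K Y = (Y : Matrix (Fin 2) (Fin 2) (mixedSpace K)).map (toComplex K) := rfl

/-- The inner map of the exponential slice, `Y ↦ g exp(Y_{w₀})`, is smooth. [folklore] -/
theorem contDiff_mul_exp_lieToComplex {hcpt : isCompact_glFiniteIntegralLevel 2 K} (g : Mat) :
    ContDiff ℝ ∞ fun Y : (AutomorphyDatum.gl 2 K hcpt).arch.lie.toSubmodule => g * NormedSpace.exp (lieToComplex K Y) := by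
  have h1 : ContDiff ℝ ∞ fun Y : (AutomorphyDatum.gl 2 K hcpt).arch.lie.toSubmodule => NormedSpace.exp (lieToComplex K Y) :=
    contDiff_exp_mat.comp (LinearMap.toContinuousLinearMap (lieToComplex K)).contDiff
  exact (LinearMap.toContinuousLinearMap (LinearMap.mulLeft ℝ g)).contDiff.comp h1

/-- **Smoothness in the archimedean variable from smoothness in `M ∈ GL₂(ℂ) ⊆ M₂(ℂ)`.**
[cite: BorelJacquetCorvallis1979, §1.1 and §4.1] -/
theorem isArchSmooth_of_contDiffOn_complex (h2 : Module.finrank ℚ K = 2) {hcpt : isCompact_glFiniteIntegralLevel 2 K}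
    {Φ : (AdelicGroupData.gl 2 K).Adelic → ℂ}
    (hΦ : ∀ c : BigHeckeGLn.FiniteAdelicGL 2 K, ContDiffOn ℝ ∞ (fun M : Mat => Φ (pt K (toGL M) c)) GL2C.Inv) :
    IsArchSmooth (AutomorphyDatum.gl 2 K hcpt).ofArch Φ := by
  intro x
  have hx : pt K (toComplexGL K 2 x) (GLn.sndHom 2 K x) = x := pt_toComplexGL_sndHom K h2 x
  have hmem : ∀ Y : (AutomorphyDatum.gl 2 K hcpt).arch.lie.toSubmodule,
      ((toComplexGL K 2 x : GL (Fin 2) ℂ) : Mat) * NormedSpace.exp (lieToComplex K Y) ∈ GL2C.Inv := fun Y =>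
    mul_mem_Inv (isUnit_det_coe _) (mem_Inv.2 ((Matrix.isUnit_iff_isUnit_det _).1 (Matrix.isUnit_exp _)))
  have heq : (fun Y : (AutomorphyDatum.gl 2 K hcpt).arch.lie.toSubmodule =>
      Φ (x * (AutomorphyDatum.gl 2 K hcpt).ofArch ((AutomorphyDatum.gl 2 K hcpt).arch.expMem ⟨Y, Y.2⟩))) =
      (fun M : Mat => Φ (pt K (toGL M) (GLn.sndHom 2 K x))) ∘
        fun Y => ((toComplexGL K 2 x : GL (Fin 2) ℂ) : Mat) * NormedSpace.exp (lieToComplex K Y) := by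
    funext Y
    rw [Function.comp_apply]
    have h1 := pt_mul_ofInfinite_expMem K h2 (hcpt := hcpt) (toComplexGL K 2 x) (GLn.sndHom 2 K x) Y
    have h2' : toGL (((toComplexGL K 2 x : GL (Fin 2) ℂ) : Mat) * NormedSpace.exp (lieToComplex K Y)) =
        toComplexGL K 2 x * expGL ((Y : Matrix (Fin 2) (Fin 2) (mixedSpace K)).map (toComplex K)) := by
      refine Units.ext ?_
      rw [coe_toGL (hmem Y), Units.val_mul, coe_expGL, lieToComplex_apply]
    rw [h2', ← h1]
    congr 1
    conv_rhs => rw [hx]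
    rfl
  rw [heq]
  exact (hΦ _).comp_contDiff (contDiff_mul_exp_lieToComplex K _) hmem

/-! ### Continuity -/

/-- **Continuity from continuity in `M` per coset**: `Φ x = F (toComplexGL x) (x_f L)` with `L`
open and `F · q` continuous for each coset `q`. [folklore] -/
theorem continuous_of_coset {Y : Type*} [TopologicalSpace Y]
    {L : Subgroup (BigHeckeGLn.FiniteAdelicGL 2 K)} (hL : IsOpen (L : Set (BigHeckeGLn.FiniteAdelicGL 2 K)))
    (F : GL (Fin 2) ℂ → BigHeckeGLn.FiniteAdelicGL 2 K ⧸ L → Y) (hF : ∀ q, Continuous fun g => F g q) :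
    Continuous fun x : GL (Fin 2) (AdeleRing (𝓞 K) K) => F (toComplexGL K 2 x) (QuotientGroup.mk (GLn.sndHom 2 K x)) := by
  haveI : DiscreteTopology (BigHeckeGLn.FiniteAdelicGL 2 K ⧸ L) := QuotientGroup.discreteTopology hL
  have hF' : Continuous fun p : GL (Fin 2) ℂ × (BigHeckeGLn.FiniteAdelicGL 2 K ⧸ L) => F p.1 p.2 :=
    continuous_prod_of_discrete_right.2 hF
  exact hF'.comp ((continuous_toComplexGL (K := K) (n := 2)).prodMk
    ((QuotientGroup.continuous_mk (N := L)).comp GLn.continuous_sndHom))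

/-! ### The archimedean height of `pt M c` -/

/-- `‖ofComplex z‖₊ = ‖z‖₊`. [folklore] -/
theorem nnnorm_ofComplex (z : ℂ) : ‖ofComplex K z‖₊ = ‖z‖₊ := by
  haveI : Nonempty {w : InfinitePlace K // w.IsComplex} := ⟨complexPlace K⟩
  refine NNReal.eq ?_
  rw [coe_nnnorm, coe_nnnorm, Prod.norm_def]
  have h1 : ‖(ofComplex K z).1‖ = 0 := by
    haveI := isEmpty_isReal K
    rw [Subsingleton.elim (ofComplex K z).1 0, norm_zero]
  have h2 : ‖(ofComplex K z).2‖ = ‖z‖ := by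
    change ‖fun _ : {w : InfinitePlace K // w.IsComplex} => z‖ = ‖z‖
    exact pi_norm_const z
  rw [h1, h2, max_eq_right (norm_nonneg _)]

/-- **The archimedean height of `pt M c` is `max_{ij} (|M_{ij}| ⊔ |(M⁻¹)_{ij}|)`.**
[cite: BorelJacquetCorvallis1979, §1.2] -/
theorem archHeight_pt (M : GL (Fin 2) ℂ) (c : BigHeckeGLn.FiniteAdelicGL 2 K) :
    GLn.archHeight 2 K (pt K M c) =
      Finset.univ.sup fun ij : Fin 2 × Fin 2 => ‖(M : Mat) ij.1 ij.2‖₊ ⊔ ‖((M⁻¹ : GL (Fin 2) ℂ) : Mat) ij.1 ij.2‖₊ := by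
  rw [GLn.archHeight, toMixed_pt, ← map_inv]
  refine Finset.sup_congr rfl fun ij _ => ?_
  change ‖((M : Mat).map (ofComplex K)) ij.1 ij.2‖₊ ⊔ ‖(((M⁻¹ : GL (Fin 2) ℂ) : Mat).map (ofComplex K)) ij.1 ij.2‖₊ = _
  rw [Matrix.map_apply, Matrix.map_apply, nnnorm_ofComplex, nnnorm_ofComplex]

/-- Entries of `M` and `M⁻¹` are bounded by the archimedean height of `pt M c`. [folklore] -/
theorem nnnorm_apply_le_archHeight_pt (M : GL (Fin 2) ℂ) (c : BigHeckeGLn.FiniteAdelicGL 2 K) (i j : Fin 2) :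
    ‖(M : Mat) i j‖₊ ≤ GLn.archHeight 2 K (pt K M c) ∧
      ‖((M⁻¹ : GL (Fin 2) ℂ) : Mat) i j‖₊ ≤ GLn.archHeight 2 K (pt K M c) := by
  rw [archHeight_pt]
  have h := Finset.le_sup (f := fun ij : Fin 2 × Fin 2 => ‖(M : Mat) ij.1 ij.2‖₊ ⊔ ‖((M⁻¹ : GL (Fin 2) ℂ) : Mat) ij.1 ij.2‖₊)
    (Finset.mem_univ (i, j))
  exact ⟨le_sup_left.trans h, le_sup_right.trans h⟩

/-- **`s(M) ≤ 5 (1 ⊔ H_∞(pt M c))`**, `s(M) = 1 + ‖M‖ + ‖M⁻¹‖` (`‖M‖ ≤ 2 max |M_{ij}|` for the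
`L^∞`-operator norm of a `2 × 2` matrix). [cite: BorelJacquetCorvallis1979, §1.2] -/
theorem size_le_five_mul_archHeight_pt (M : GL (Fin 2) ℂ) (c : BigHeckeGLn.FiniteAdelicGL 2 K) :
    1 + ‖(M : Mat)‖ + ‖(M : Mat)⁻¹‖ ≤ 5 * (1 ⊔ (GLn.archHeight 2 K (pt K M c) : ℝ)) := by
  set H : ℝ := 1 ⊔ (GLn.archHeight 2 K (pt K M c) : ℝ) with hH
  have hH1 : 1 ≤ H := le_sup_left
  have hH0 : 0 ≤ H := zero_le_one.trans hH1
  have hent : ∀ i j, ‖(M : Mat) i j‖ ≤ H := fun i j => by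
    have := (nnnorm_apply_le_archHeight_pt K M c i j).1
    exact (NNReal.coe_le_coe.2 this).trans le_sup_right
  have hent' : ∀ i j, ‖(M : Mat)⁻¹ i j‖ ≤ H := fun i j => by
    have := (nnnorm_apply_le_archHeight_pt K M c i j).2
    rw [Matrix.coe_units_inv] at this
    exact (NNReal.coe_le_coe.2 this).trans le_sup_right
  have h1 : ‖(M : Mat)‖ ≤ 2 * H := norm_le_two_mul_of_entry_le _ hH0 hent
  have h2 : ‖(M : Mat)⁻¹‖ ≤ 2 * H := norm_le_two_mul_of_entry_le _ hH0 hent'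
  linarith

/-- **`1 ⊔ H_∞(pt M c) ≤ s(M)`** (entries are bounded by the operator norm). [cite: BorelJacquetCorvallis1979, §1.2] -/
theorem archHeight_pt_le_size (M : GL (Fin 2) ℂ) (c : BigHeckeGLn.FiniteAdelicGL 2 K) :
    (1 ⊔ (GLn.archHeight 2 K (pt K M c) : ℝ)) ≤ 1 + ‖(M : Mat)‖ + ‖(M : Mat)⁻¹‖ := by
  refine sup_le (one_le_size _) ?_
  rw [archHeight_pt]
  have h0 : 0 ≤ 1 + ‖(M : Mat)‖ + ‖(M : Mat)⁻¹‖ := zero_le_one.trans (one_le_size _)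
  rw [← Real.coe_toNNReal _ h0, NNReal.coe_le_coe, Finset.sup_le_iff]
  intro ij _
  rw [Real.le_toNNReal_iff_coe_le h0, NNReal.coe_max, coe_nnnorm, coe_nnnorm, Matrix.coe_units_inv]
  exact max_le (norm_apply_le_size _ _ _) (norm_inv_apply_le_size _ _ _)

end GL2CAut

end Literature.NumberTheory.Automorphic

end
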